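import Summits.QuantumFields.YangMills.Theorems.FradkinShenkerFlowStrongPinningPoincareHeatBathGap
import HarnessLib

/-!
# Robust ball (Y2) — THE HEAT-BATH SWEEP CONTRACTS THE VARIANCE AT THE SQUARED RATE: `Var_μ(P f) ≤ (1 − (2A|ι|)⁻¹)² Var_μ(f)`

HONEST FRAMING: venture file of the cell `pub-ymgap` (QuantumFields programme), track ROBUST-BALL, seat rb-p2 (g13); the SHARP form of `HeatBathSweep.variance_sweep_le`
(which has the factor `1 − (2A|ι|)⁻¹`, from Jensen): abstract Markov-operator algebra for the random-scan single-site heat-bath operator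
`P f(x) = |ι|⁻¹ ∑_i ∫ f(x[i ↦ e]) dν_i^x(e)` of a tilted product measure `μ = (lam^{⊗ι}).tilted V` (the YangMills summit's `StrongPinningPoincare.HeatBath` setting;
this file imports only that kernel algebra).  `P` is `μ`-symmetric (`integral_randomScan_mul_comm`), POSITIVE (`sq_integral_le_integral_mul_randomScan`:
`(∫ f)² ≤ ∫ f·Pf`, each `P_i` being a symmetric idempotent) and LINEAR (`randomScan_add_mul`); a heat-bath Poincaré inequality `Var_μ(F) ≤ A ∑_i ∫∫ (F − F∘[i↦e])²`
is the SPECTRAL-GAP form `∫ f·Pf − (∫ f)² ≤ θ Var_μ(f)`, `θ = 1 − (2A|ι|)⁻¹` (`integral_mul_randomScan_sub_sq_le`, via the engine's Dirichlet-form identity); and for a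
positive symmetric operator the numerical radius on mean-zero functions IS the norm (polarization + the parallelogram law for the variance), whence
★★★ `variance_sweep_le_sq`: `Var_μ(P f) ≤ θ² Var_μ(f)` and `variance_sweep_iterate_le_sq`: `Var_μ(P^k f) ≤ θ^{2k} Var_μ(f)` — ONE SWEEP contracts the `L²(μ)`-variance by
`≈ e^{−1/A}` (relaxation time `≤ A` sweeps, half of `HeatBathSweep`'s `2A`); with `HeatBathMixing` (any one-step contraction `θ'`), warm-start total variation
`≤ θ^k ‖h − 1‖₂`.  For the cell's `SU(2)`, `d = 4`, `0 ≤ β_W < 2/9` (`A = (2 − 9β_W)⁻¹`): `Var(P^k f) ≤ (1 − (1 − 9β_W/2)/n)^{2k} Var f`, relaxation within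
`½(1 − 9β_W/2)⁻¹` sweeps and total variation `≤ ε` after `(1 − 9β_W/2)⁻¹ log(‖h − 1‖₂/ε)` sweeps, uniformly in the volume (cells: `HeatBathSweepCells`).
LATTICE ∕ algorithmic statements at STRONG COUPLING; no Markov-chain object is constructed; nothing about `β → ∞`, the continuum or Clay.
0 sorry, 0 definitions.  References: P. Diaconis, L. Saloff-Coste, Ann. Appl. Probab. 6 (1996) 695–750; M. Creutz, Phys. Rev. D 21 (1980) 2308;
L. Wu, Ann. Probab. 34 (2006) 1960.  Everything here is proved. [folklore]
-/

noncomputable section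

open MeasureTheory Function Real Finset ProbabilityTheory
open Summit.QuantumFields.YangMills.Theorems.StrongPinningPoincare

namespace Summit.Ventures.YMGap.RobustBall.HeatBathSweep

section Abstract

variable {ι : Type*} [Fintype ι] [DecidableEq ι] {E : Type*} [MeasurableSpace E]
  (lam : Measure E) [IsProbabilityMeasure lam] {V : (ι → E) → ℝ}

omit [IsProbabilityMeasure lam] in
/-- **`P` is linear**: `P(u + s·v) = P u + s·P v` pointwise, for bounded measurable `u`, `v`. [folklore] -/
theorem randomScan_add_mul {u v : (ι → E) → ℝ} (hu : Measurable u) (hv : Measurable v)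
    {Mu Mv : ℝ} (hMu : ∀ x, |u x| ≤ Mu) (hMv : ∀ x, |v x| ≤ Mv) (s : ℝ) (x : ι → E) :
    (Fintype.card ι : ℝ)⁻¹ * ∑ i, ∫ e, (u (update x i e) + s * v (update x i e)) ∂(lam.tilted fun e => V (update x i e)) =
      (Fintype.card ι : ℝ)⁻¹ * ∑ i, ∫ e, u (update x i e) ∂(lam.tilted fun e => V (update x i e)) +
        s * ((Fintype.card ι : ℝ)⁻¹ * ∑ i, ∫ e, v (update x i e) ∂(lam.tilted fun e => V (update x i e))) := by
  have h : ∀ i, ∫ e, (u (update x i e) + s * v (update x i e)) ∂(lam.tilted fun e => V (update x i e)) =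
      (∫ e, u (update x i e) ∂(lam.tilted fun e => V (update x i e))) + s * ∫ e, v (update x i e) ∂(lam.tilted fun e => V (update x i e)) := by
    intro i
    have iu : Integrable (fun e => u (update x i e)) (lam.tilted fun e => V (update x i e)) :=
      HeatBath.integrable_of_abs_le (hu.comp (measurable_update x)) fun e => hMu _
    have iv : Integrable (fun e => s * v (update x i e)) (lam.tilted fun e => V (update x i e)) :=
      (HeatBath.integrable_of_abs_le (hv.comp (measurable_update x)) fun e => hMv _).const_mul s
    rw [integral_add iu iv, integral_const_mul]
  simp_rw [h]
  rw [Finset.sum_add_distrib, ← Finset.mul_sum]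
  ring

/-- **`P` is a positive operator**: `(∫ f dμ)² ≤ ∫ f · P f dμ` for bounded measurable `f` — each single-site heat bath `P_i` is a `μ`-symmetric idempotent, so
`∫ f · P_i f dμ = ∫ (P_i f)² dμ ≥ (∫ P_i f dμ)² = (∫ f dμ)²`. [folklore] -/
theorem sq_integral_le_integral_mul_randomScan [Nonempty ι] (hV : Measurable V) {Bv : ℝ} (hB : ∀ x, |V x| ≤ Bv) {f : (ι → E) → ℝ}
    (hf : Measurable f) {M : ℝ} (hM : ∀ x, |f x| ≤ M) :
    (∫ x, f x ∂((Measure.pi fun _ : ι => lam).tilted V)) ^ 2 ≤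
      ∫ x, f x * ((Fintype.card ι : ℝ)⁻¹ * ∑ i, ∫ e, f (update x i e) ∂(lam.tilted fun e => V (update x i e)))
        ∂((Measure.pi fun _ : ι => lam).tilted V) := by
  haveI := HeatBath.isProbabilityMeasure_gibbs lam hV hB
  set μ := (Measure.pi fun _ : ι => lam).tilted V with hμ
  set n : ℝ := (Fintype.card ι : ℝ) with hn
  have hn0 : 0 < n := by rw [hn]; exact_mod_cast Fintype.card_pos
  set Pi : ι → (ι → E) → ℝ := fun i x => ∫ e, f (update x i e) ∂(lam.tilted fun e => V (update x i e)) with hPi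
  have hPim : ∀ i, Measurable (Pi i) := fun i => HeatBath.measurable_heatBath lam hV i hf
  have hPib : ∀ i x, |Pi i x| ≤ M := fun i x => HeatBath.abs_heatBath_le lam hV hB x i hM
  -- `∫ f · P_i f = ∫ (P_i f)²`
  have hsq : ∀ i, ∫ x, f x * Pi i x ∂μ = ∫ x, Pi i x ^ 2 ∂μ := fun i => by
    have hidem : ∀ x, ∫ e, Pi i (update x i e) ∂(lam.tilted fun e => V (update x i e)) = Pi i x := fun x => by
      haveI := HeatBath.isProbabilityMeasure_heatBath lam hV hB x i
      have h1 : ∀ e, Pi i (update x i e) = Pi i x := fun e => by simp only [hPi, update_idem]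
      simp_rw [h1]
      simp
    have hsym := HeatBath.integral_mul_heatBath_comm lam hV hB i hf (hPim i) hM (hPib i) (f := f) (h := Pi i)
    simp_rw [hidem] at hsym
    rw [← hsym]
    simp_rw [sq]
    rfl
  -- `(∫ f)² = (∫ P_i f)² ≤ ∫ (P_i f)²`
  have hcs : ∀ i, (∫ x, f x ∂μ) ^ 2 ≤ ∫ x, Pi i x ^ 2 ∂μ := fun i => by
    have hmean : ∫ x, Pi i x ∂μ = ∫ x, f x ∂μ := HeatBath.integral_heatBath lam hV hB i hf hM
    have h1 : ∀ _x : ι → E, |(1 : ℝ)| ≤ 1 := fun _ => le_of_eq abs_one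
    have h := HeatBath.sq_integral_mul_le μ (hPim i) measurable_const (hPib i) h1
    simp only [mul_one, one_pow, integral_const, probReal_univ, smul_eq_mul] at h
    rw [← hmean]
    simpa using h
  -- average over the sites
  have e1 : ∀ x, f x * (n⁻¹ * ∑ i, Pi i x) = n⁻¹ * ∑ i, f x * Pi i x := fun x => by
    simp only [Finset.mul_sum]
    exact Finset.sum_congr rfl fun i _ => by ring
  have hfPi : ∀ i, Integrable (fun x => f x * Pi i x) μ := fun i => HeatBath.integrable_mul_of_abs_le μ hf (hPim i) hM (hPib i)
  show (∫ x, f x ∂μ) ^ 2 ≤ ∫ x, f x * (n⁻¹ * ∑ i, Pi i x) ∂μ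
  simp_rw [e1]
  rw [integral_const_mul, integral_finsetSum _ fun i _ => hfPi i]
  calc (∫ x, f x ∂μ) ^ 2 = n⁻¹ * ∑ _i : ι, (∫ x, f x ∂μ) ^ 2 := by
        rw [Finset.sum_const, Finset.card_univ, nsmul_eq_mul, ← hn]; field_simp
    _ ≤ n⁻¹ * ∑ i, ∫ x, f x * Pi i x ∂μ := by
        refine mul_le_mul_of_nonneg_left (Finset.sum_le_sum fun i _ => ?_) (inv_nonneg.2 hn0.le)
        rw [hsq i]; exact hcs i

/-- **The spectral-gap form of a heat-bath Poincaré inequality**: if `Var_μ(F) ≤ A ∑_i ∫∫ (F − F∘[i↦e])² dν_i^x dμ` for all bounded measurable `F`, then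
`∫ f · P f dμ − (∫ f dμ)² ≤ (1 − (2A|ι|)⁻¹) Var_μ(f)` (the engine's Dirichlet-form identity `∑_i ∫∫ (f − f∘[i↦e])² = 2|ι|(∫ f² − ∫ f·Pf)`). [folklore] -/
theorem integral_mul_randomScan_sub_sq_le [Nonempty ι] (hV : Measurable V) {Bv : ℝ} (hB : ∀ x, |V x| ≤ Bv) {A : ℝ}
    (hP : ∀ (F : (ι → E) → ℝ), Measurable F → (∃ M : ℝ, ∀ x, |F x| ≤ M) →
      variance F ((Measure.pi fun _ : ι => lam).tilted V) ≤
        A * ∑ i, ∫ x, ∫ e, (F x - F (update x i e)) ^ 2 ∂(lam.tilted fun e => V (update x i e)) ∂((Measure.pi fun _ : ι => lam).tilted V))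
    (hA : 0 < A) {f : (ι → E) → ℝ} (hf : Measurable f) {M : ℝ} (hM : ∀ x, |f x| ≤ M) :
    ∫ x, f x * ((Fintype.card ι : ℝ)⁻¹ * ∑ i, ∫ e, f (update x i e) ∂(lam.tilted fun e => V (update x i e)))
        ∂((Measure.pi fun _ : ι => lam).tilted V) - (∫ x, f x ∂((Measure.pi fun _ : ι => lam).tilted V)) ^ 2 ≤
      (1 - (2 * A * Fintype.card ι)⁻¹) * variance f ((Measure.pi fun _ : ι => lam).tilted V) := by
  haveI := HeatBath.isProbabilityMeasure_gibbs lam hV hB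
  set μ := (Measure.pi fun _ : ι => lam).tilted V with hμ
  set n : ℝ := (Fintype.card ι : ℝ) with hn
  have hn0 : 0 < n := by rw [hn]; exact_mod_cast Fintype.card_pos
  have hD := HeatBath.sum_integral_integral_sq_sub_eq lam hV hB hf hM
  have hPoinc := hP f hf ⟨M, hM⟩
  rw [hD] at hPoinc
  have hmemf : MemLp f 2 μ := MemLp.of_bound hf.aestronglyMeasurable M (ae_of_all _ fun x => by rw [Real.norm_eq_abs]; exact hM x)
  have hvf : variance f μ = (∫ x, f x ^ 2 ∂μ) - (∫ x, f x ∂μ) ^ 2 := by rw [variance_eq_sub hmemf]; rfl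
  set S : ℝ := ∫ x, f x * (n⁻¹ * ∑ i, ∫ e, f (update x i e) ∂(lam.tilted fun e => V (update x i e))) ∂μ with hS
  set I2 : ℝ := ∫ x, f x ^ 2 ∂μ with hI2
  set m : ℝ := ∫ x, f x ∂μ with hm
  rw [hvf] at hPoinc ⊢
  have h2 : (2 * A * n)⁻¹ * (I2 - m ^ 2) ≤ I2 - S := by
    rw [inv_mul_le_iff₀ (by positivity)]
    linarith
  calc S - m ^ 2 = (I2 - m ^ 2) - (I2 - S) := by ring
    _ ≤ (I2 - m ^ 2) - (2 * A * n)⁻¹ * (I2 - m ^ 2) := by linarith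
    _ = (1 - (2 * A * n)⁻¹) * (I2 - m ^ 2) := by ring

/-- ★★★ **THE HEAT-BATH SWEEP CONTRACTS THE VARIANCE AT THE SQUARED RATE** (abstract, sharp form of `HeatBathSweep.variance_sweep_le`): if the tilted product measure
`μ` satisfies the heat-bath Poincaré inequality `Var_μ(F) ≤ A ∑_i ∫∫ (F(x) − F(x[i ↦ e]))² dν_i^x dμ` for every bounded measurable `F` (with `(2A|ι|)⁻¹ ≤ 1`), then
`Var_μ(P f) ≤ (1 − (2A|ι|)⁻¹)² Var_μ(f)` for every bounded measurable `f`.  Proof: `θ = 1 − (2A|ι|)⁻¹` bounds the numerical range of the positive symmetric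
operator `P` on mean-zero functions; polarization `4s·Var(Pf) = Q(f + s Pf) − Q(f − s Pf)` (`Q(w) = ∫ w·Pw − (∫ w)²`, `0 ≤ Q ≤ θ Var`) and the parallelogram law
`Var(f + s g) + Var(f − s g) = 2 Var f + 2s² Var g` give `4s Var(Pf) ≤ 2θ(Var f + s² Var(Pf))`, and `s = 1/θ` concludes. [folklore] -/
theorem variance_sweep_le_sq [Nonempty ι] (hV : Measurable V) {Bv : ℝ} (hB : ∀ x, |V x| ≤ Bv) {A : ℝ}
    (hP : ∀ (F : (ι → E) → ℝ), Measurable F → (∃ M : ℝ, ∀ x, |F x| ≤ M) →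
      variance F ((Measure.pi fun _ : ι => lam).tilted V) ≤
        A * ∑ i, ∫ x, ∫ e, (F x - F (update x i e)) ^ 2 ∂(lam.tilted fun e => V (update x i e)) ∂((Measure.pi fun _ : ι => lam).tilted V))
    (hA : 0 < A) (hA1 : (2 * A * Fintype.card ι)⁻¹ ≤ 1) {f : (ι → E) → ℝ} (hf : Measurable f) {M : ℝ} (hM : ∀ x, |f x| ≤ M) :
    variance (fun x => (Fintype.card ι : ℝ)⁻¹ * ∑ i, ∫ e, f (update x i e) ∂(lam.tilted fun e => V (update x i e)))
        ((Measure.pi fun _ : ι => lam).tilted V) ≤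
      (1 - (2 * A * Fintype.card ι)⁻¹) ^ 2 * variance f ((Measure.pi fun _ : ι => lam).tilted V) := by
  haveI := HeatBath.isProbabilityMeasure_gibbs lam hV hB
  set μ := (Measure.pi fun _ : ι => lam).tilted V with hμ
  set n : ℝ := (Fintype.card ι : ℝ) with hn
  have hn0 : 0 < n := by rw [hn]; exact_mod_cast Fintype.card_pos
  set θ : ℝ := 1 - (2 * A * n)⁻¹ with hθ
  have hθ0 : 0 ≤ θ := by rw [hθ]; linarith
  -- `g = P f`
  set g : (ι → E) → ℝ := fun x => n⁻¹ * ∑ i, ∫ e, f (update x i e) ∂(lam.tilted fun e => V (update x i e)) with hg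
  have hgm : Measurable g := HeatBath.measurable_randomScan lam hV hf
  have hgb : ∀ x, |g x| ≤ M := fun x => HeatBath.abs_randomScan_le lam hV hB hM x
  set Pg : (ι → E) → ℝ := fun x => n⁻¹ * ∑ i, ∫ e, g (update x i e) ∂(lam.tilted fun e => V (update x i e)) with hPg
  have hPgm : Measurable Pg := HeatBath.measurable_randomScan lam hV hgm
  have hPgb : ∀ x, |Pg x| ≤ M := fun x => HeatBath.abs_randomScan_le lam hV hB hgb x
  have hmg : ∫ x, g x ∂μ = ∫ x, f x ∂μ := HeatBath.integral_randomScan lam hV hB hf hM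
  set m : ℝ := ∫ x, f x ∂μ with hm
  -- second moments
  have hfg : Integrable (fun x => f x * g x) μ := HeatBath.integrable_mul_of_abs_le μ hf hgm hM hgb
  have hfPg : Integrable (fun x => f x * Pg x) μ := HeatBath.integrable_mul_of_abs_le μ hf hPgm hM hPgb
  have hgg : Integrable (fun x => g x * g x) μ := HeatBath.integrable_mul_of_abs_le μ hgm hgm hgb hgb
  have hgPg : Integrable (fun x => g x * Pg x) μ := HeatBath.integrable_mul_of_abs_le μ hgm hPgm hgb hPgb
  -- symmetry: `∫ f · Pg = ∫ (Pf) · g = ∫ g²`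
  have hsym : ∫ x, f x * Pg x ∂μ = ∫ x, g x * g x ∂μ := by
    have h := HeatBath.integral_randomScan_mul_comm lam hV hB hf hgm hM hgb
    -- `h : ∫ (P f) * g = ∫ f * (P g)`
    rw [← h]
  -- the variance of `g`
  have hmemg : MemLp g 2 μ := MemLp.of_bound hgm.aestronglyMeasurable M (ae_of_all _ fun x => by rw [Real.norm_eq_abs]; exact hgb x)
  have hmemf : MemLp f 2 μ := MemLp.of_bound hf.aestronglyMeasurable M (ae_of_all _ fun x => by rw [Real.norm_eq_abs]; exact hM x)
  have hvg : variance g μ = (∫ x, g x * g x ∂μ) - m ^ 2 := by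
    rw [variance_eq_sub hmemg, ← hmg]
    simp only [Pi.pow_apply, sq]
  -- the test functions `w_s = f + s g` and the quadratic form `Q(w) = ∫ w Pw − (∫ w)²`
  have hfi : Integrable f μ := HeatBath.integrable_of_abs_le hf hM
  have hgi : Integrable g μ := HeatBath.integrable_of_abs_le hgm hgb
  have hws : ∀ s : ℝ, Measurable (fun x => f x + s * g x) ∧ (∀ x, |f x + s * g x| ≤ M + |s| * M) := fun s =>
    ⟨hf.add (hgm.const_mul s), fun x => (abs_add_le _ _).trans (add_le_add (hM x)
      (by rw [abs_mul]; exact mul_le_mul_of_nonneg_left (hgb x) (abs_nonneg _)))⟩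
  have hQ : ∀ s : ℝ, ∫ x, (f x + s * g x) * ((Fintype.card ι : ℝ)⁻¹ * ∑ i, ∫ e, (f (update x i e) + s * g (update x i e))
      ∂(lam.tilted fun e => V (update x i e))) ∂μ - (∫ x, (f x + s * g x) ∂μ) ^ 2 =
      (∫ x, f x * g x ∂μ) + 2 * s * (∫ x, g x * g x ∂μ) + s ^ 2 * (∫ x, g x * Pg x ∂μ) - (1 + s) ^ 2 * m ^ 2 := by
    intro s
    have hlin : ∀ x, (Fintype.card ι : ℝ)⁻¹ * ∑ i, ∫ e, (f (update x i e) + s * g (update x i e)) ∂(lam.tilted fun e => V (update x i e)) =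
        g x + s * Pg x := fun x => randomScan_add_mul lam hf hgm hM hgb s x
    simp_rw [hlin]
    have e1 : ∀ x, (f x + s * g x) * (g x + s * Pg x) = (f x * g x + s * (f x * Pg x)) + (s * (g x * g x) + s ^ 2 * (g x * Pg x)) :=
      fun x => by ring
    simp_rw [e1]
    have i1 : Integrable (fun x => f x * g x + s * (f x * Pg x)) μ := hfg.add (hfPg.const_mul s)
    have i2 : Integrable (fun x => s * (g x * g x) + s ^ 2 * (g x * Pg x)) μ := (hgg.const_mul s).add (hgPg.const_mul _)
    have i3 : Integrable (fun x => s * g x) μ := hgi.const_mul s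
    rw [integral_add i1 i2, integral_add hfg (hfPg.const_mul s), integral_add (hgg.const_mul s) (hgPg.const_mul _), integral_const_mul,
      integral_const_mul, integral_const_mul, hsym, integral_add hfi i3, integral_const_mul, hmg]
    ring
  -- `Q(w_s) ≤ θ Var(w_s)` (gap) and `0 ≤ Q(w_s)` (positivity)
  have hgap : ∀ s : ℝ, (∫ x, f x * g x ∂μ) + 2 * s * (∫ x, g x * g x ∂μ) + s ^ 2 * (∫ x, g x * Pg x ∂μ) - (1 + s) ^ 2 * m ^ 2 ≤
      θ * variance (fun x => f x + s * g x) μ := fun s => by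
    have h := integral_mul_randomScan_sub_sq_le lam hV hB hP hA (hws s).1 (hws s).2
    rw [hQ s] at h
    exact h
  have hpos : ∀ s : ℝ, 0 ≤ (∫ x, f x * g x ∂μ) + 2 * s * (∫ x, g x * g x ∂μ) + s ^ 2 * (∫ x, g x * Pg x ∂μ) - (1 + s) ^ 2 * m ^ 2 := fun s => by
    have h := sq_integral_le_integral_mul_randomScan lam hV hB (hws s).1 (hws s).2
    rw [← sub_nonneg, hQ s] at h
    exact h
  -- the variance of `w_s`
  have hvar : ∀ s : ℝ, variance (fun x => f x + s * g x) μ = variance f μ + 2 * (s * cov[f, g; μ]) + s ^ 2 * variance g μ := fun s => by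
    rw [variance_fun_add hmemf (hmemg.const_mul s), covariance_const_mul_right, variance_const_mul]
  -- polarization + parallelogram: `4 s Var g ≤ 2θ (Var f + s² Var g)`
  have key : ∀ s : ℝ, 4 * s * variance g μ ≤ 2 * θ * (variance f μ + s ^ 2 * variance g μ) := fun s => by
    have h1 := hgap s
    have h2 := hpos (-s)
    have hθv : 0 ≤ θ * variance (fun x => f x + -s * g x) μ := mul_nonneg hθ0 (variance_nonneg _ _)
    have hdiff : ((∫ x, f x * g x ∂μ) + 2 * s * (∫ x, g x * g x ∂μ) + s ^ 2 * (∫ x, g x * Pg x ∂μ) - (1 + s) ^ 2 * m ^ 2) -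
        ((∫ x, f x * g x ∂μ) + 2 * (-s) * (∫ x, g x * g x ∂μ) + (-s) ^ 2 * (∫ x, g x * Pg x ∂μ) - (1 + -s) ^ 2 * m ^ 2) =
        4 * s * ((∫ x, g x * g x ∂μ) - m ^ 2) := by ring
    calc 4 * s * variance g μ = 4 * s * ((∫ x, g x * g x ∂μ) - m ^ 2) := by rw [hvg]
      _ ≤ θ * variance (fun x => f x + s * g x) μ - 0 := by rw [← hdiff]; exact sub_le_sub h1 h2
      _ ≤ θ * variance (fun x => f x + s * g x) μ + θ * variance (fun x => f x + -s * g x) μ := by linarith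
      _ = 2 * θ * (variance f μ + s ^ 2 * variance g μ) := by rw [hvar s, hvar (-s)]; ring
  -- conclude with `s = 1/θ` (or `s = 1` when `θ = 0`)
  have hX0 : 0 ≤ variance g μ := variance_nonneg _ _
  show variance g μ ≤ θ ^ 2 * variance f μ
  rcases hθ0.eq_or_lt with hθz | hθp
  · have h := key 1
    rw [← hθz] at h ⊢
    nlinarith
  · have h := mul_le_mul_of_nonneg_left (key θ⁻¹) hθ0
    have hθne : θ ≠ 0 := hθp.ne'
    have e1 : θ * (4 * θ⁻¹ * variance g μ) = 4 * variance g μ := by field_simp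
    have e2 : θ * (2 * θ * (variance f μ + θ⁻¹ ^ 2 * variance g μ)) = 2 * (θ ^ 2 * variance f μ) + 2 * variance g μ := by
      field_simp
    rw [e1, e2] at h
    linarith

/-- ★★★ **ITERATED SWEEPS, SQUARED RATE**: under the same heat-bath Poincaré hypothesis, `Var_μ(P^k f) ≤ (1 − (2A|ι|)⁻¹)^{2k} Var_μ(f)` for every bounded measurable `f`
and every `k` — one sweep (`k = |ι|` single-site updates) contracts the `L²(μ)`-variance by `≤ e^{−1/A}`. [folklore] -/
theorem variance_sweep_iterate_le_sq [Nonempty ι] (hV : Measurable V) {Bv : ℝ} (hB : ∀ x, |V x| ≤ Bv) {A : ℝ}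
    (hP : ∀ (F : (ι → E) → ℝ), Measurable F → (∃ M : ℝ, ∀ x, |F x| ≤ M) →
      variance F ((Measure.pi fun _ : ι => lam).tilted V) ≤
        A * ∑ i, ∫ x, ∫ e, (F x - F (update x i e)) ^ 2 ∂(lam.tilted fun e => V (update x i e)) ∂((Measure.pi fun _ : ι => lam).tilted V))
    (hA : 0 < A) (hA1 : (2 * A * Fintype.card ι)⁻¹ ≤ 1) {f : (ι → E) → ℝ} (hf : Measurable f) {M : ℝ} (hM : ∀ x, |f x| ≤ M) (k : ℕ) :
    variance ((fun g : (ι → E) → ℝ => fun x => (Fintype.card ι : ℝ)⁻¹ * ∑ i, ∫ e, g (update x i e) ∂(lam.tilted fun e => V (update x i e)))^[k] f)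
        ((Measure.pi fun _ : ι => lam).tilted V) ≤
      ((1 - (2 * A * Fintype.card ι)⁻¹) ^ 2) ^ k * variance f ((Measure.pi fun _ : ι => lam).tilted V) := by
  set T : ((ι → E) → ℝ) → (ι → E) → ℝ := fun g x => (Fintype.card ι : ℝ)⁻¹ * ∑ i, ∫ e, g (update x i e) ∂(lam.tilted fun e => V (update x i e)) with hT
  have hTm : ∀ {g : (ι → E) → ℝ}, Measurable g → Measurable (T g) := fun hg => HeatBath.measurable_randomScan lam hV hg
  have hTb : ∀ {g : (ι → E) → ℝ}, (∀ x, |g x| ≤ M) → ∀ x, |T g x| ≤ M := fun hgb x => HeatBath.abs_randomScan_le lam hV hB hgb x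
  have key : ∀ k : ℕ, Measurable (T^[k] f) ∧ (∀ x, |(T^[k] f) x| ≤ M) ∧
      variance (T^[k] f) ((Measure.pi fun _ : ι => lam).tilted V) ≤
        ((1 - (2 * A * Fintype.card ι)⁻¹) ^ 2) ^ k * variance f ((Measure.pi fun _ : ι => lam).tilted V) := by
    intro k
    induction k with
    | zero => exact ⟨hf, hM, by simp⟩
    | succ k ih =>
      obtain ⟨hkm, hkb, hkv⟩ := ih
      refine ⟨?_, ?_, ?_⟩
      · rw [Function.iterate_succ_apply']; exact hTm hkm
      · rw [Function.iterate_succ_apply']; exact hTb hkb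
      · rw [Function.iterate_succ_apply', pow_succ, mul_comm (_ ^ k), mul_assoc]
        exact (variance_sweep_le_sq lam hV hB hP hA hA1 hkm hkb).trans (mul_le_mul_of_nonneg_left hkv (sq_nonneg _))
  exact (key k).2.2

end Abstract

end Summit.Ventures.YMGap.RobustBall.HeatBathSweep

end
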